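import Summits.Ventures.CertifiedManyBodySolver.Rows.CorrWindowCertKernelChainQuotAdjFastNKey
import Summits.Ventures.CertifiedManyBodySolver.Rows.CorrWindowCertKernelChainQuotAdjFastBox
import HarnessLib

/-!
# The chain step on LETTER CODES (part 3): `encL` facts, box code maps, the stages and `stepEQN`

Parts 1–2 (`Rows/CorrWindowCertKernelChainQuotAdjFastN{,Key}.lean`) give the code engine, its transport and the key injectivity. Here:
`encL_lt_iff` / `encL_bd` (the letter encoding `SOSDual.encL` of `Rows/SOSDualCert.lean` is strictly monotone for the `Lex` order of
`Orb (Fin k)` and its digits are below any base `B ≥ 2k + 1`), `normalizeM_single_{some,none1,none2}` (a singleton `normalizeM` read off the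
two signed sorts); the box letter maps on codes `pushC`/`gqC` (= `pushN`/`gqN` of `Rows/CorrWindowCertKernelChainQuotAdjFastMaps.lean` read
through `encL`: `encL_pushN`, `encL_gqN`) and **`gqK`** (the move with the `D₄` case dispatched once per hint and its constants folded: nine
ℕ operations per letter; `gqK_encL`); the STAGES of the code step — `hintRowsN` (rows straight from `monoNFN`, one key each), `dropBehindN`,
`annotateN` (key match), `zeroTestN`, `quotOutNM`, `termsToPolyKM`, `adjOutNM`, `toEnc` — and **`stepEQN r R vmax B C T H`** (falls back to
`stepEQA (boxQuot r R vmax)` unless `r + vmax ≤ R` and `2·boxN R + 1 ≤ B`). The equation is part 4 (`…FastNBox.lean`).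

HONEST FRAMING (xx1): Lean plumbing towards «tier P» — a PROOF-TERM-only speed-up of the kernel replay of chain steps; every
`step_s` STATEMENT, accumulator literal, census/EQUAL artefact, `ChainQAOK`/closer stays byte-identical. Nothing of record moves; no
certificate is evaluated here; no claim node is discharged; CONTROL/CALIBRATION context; silent on the presence of superconductivity;
not a `T_c` or phase sentence; nothing about any material; no summit statement is proved by this file. Cell `hubbard-obs` ×
`hubbard-downfold` (D-0154 (1)(C) La214), seat hubbard-cov-la214-box-2 g6 (`prover-hubbard-cov-la214-box-2-g6-0`), zero compute.

References: C. Jansson, D. Chaykin, C. Keil, SIAM J. Numer. Anal. 46 (2008) 180 [JanssonChaykinKeil2008]; X. Han, arXiv:2006.06002 §3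
[Han2020Bootstrap]; O. Bratteli, D. W. Robinson, *Operator Algebras and Quantum Statistical Mechanics 2* §5.2.2 [BratteliRobinsonII1997].
-/

namespace Summit.Ventures.CertifiedManyBodySolver

namespace CARPolyWindow

open Summit.Ventures.CertifiedQuantumChemistry Summit.Ventures.CertifiedQuantumChemistry.CARPoly
open Literature.MathematicalPhysics.QuantumLattice Literature.MathematicalPhysics.QuantumLattice.HubbardWave0

/-! ## §1 The letter encoding `encL`; singleton `normalizeM` -/

section EncL

variable {k : ℕ}

/-- `encL` reads the site index. [folklore] -/
theorem encL_div_two (b : Orb (Fin k)) : SOSDual.encL b / 2 = (ofLex b).1.val := by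
  unfold SOSDual.encL; have := (ofLex b).2.isLt; omega

/-- `encL` reads the spin. [folklore] -/
theorem encL_mod_two (b : Orb (Fin k)) : SOSDual.encL b % 2 = (ofLex b).2.val := by
  unfold SOSDual.encL; have := (ofLex b).2.isLt; omega

/-- **`encL` is strictly monotone for the `Lex` order of `Orb (Fin k)`.** [folklore] -/
theorem encL_lt_iff (x y : Orb (Fin k)) : SOSDual.encL x < SOSDual.encL y ↔ x < y := by
  have hx := (ofLex x).2.isLt; have hy := (ofLex y).2.isLt
  have e : x < y ↔ (ofLex x).1 < (ofLex y).1 ∨ (ofLex x).1 = (ofLex y).1 ∧ (ofLex x).2 < (ofLex y).2 := by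
    rw [← Prod.Lex.toLex_lt_toLex]; rfl
  rw [e, Fin.lt_def, Fin.lt_def, Fin.ext_iff]
  unfold SOSDual.encL
  omega

/-- `encL` of an explicit orbital. [folklore] -/
theorem encL_orb (i : Fin k) (σ : Fin 2) : SOSDual.encL (orb i σ) = 2 * i.val + σ.val := rfl

/-- Every digit `encL a + 1` is below a base `B ≥ 2k + 1`. [folklore] -/
theorem encL_bd {B : ℕ} (hB : 2 * k + 1 ≤ B) (a : Orb (Fin k)) : SOSDual.encL a + 1 < B := by
  unfold SOSDual.encL; have := (ofLex a).1.isLt; have := (ofLex a).2.isLt; omega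

end EncL

section Single

variable {α : Type*} [LinearOrder α]

/-- `collect` of one term. [folklore] -/
theorem collect_single (enc : α → ℕ) (B : ℕ) (n : CARPoly.Mono α) (c : ℚ) :
    CARPoly.collect enc B [(n, c)] = if c = 0 then [] else [(n, c)] := by
  simp [CARPoly.collect, CARPoly.sortByKey, CARPoly.mergeAll, CARPoly.mergeAdj, CARPoly.emit]

/-- `monoNF` when both halves sort. [cite: BratteliRobinsonII1997, §5.2.2] -/
theorem monoNF_some {m : CARPoly.Mono α} {lc la : List α × Bool} (h1 : sortS m.1 = some lc) (h2 : sortS m.2 = some la) :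
    monoNF m = [((lc.1, la.1), sgnQ (xor lc.2 la.2))] := by
  unfold monoNF; rw [h1, h2]

/-- `monoNF` when the creators do not sort. [folklore] -/
theorem monoNF_none1 {m : CARPoly.Mono α} (h1 : sortS m.1 = none) : monoNF m = [] := by
  unfold monoNF; rw [h1]

/-- `monoNF` when the annihilators do not sort. [folklore] -/
theorem monoNF_none2 {m : CARPoly.Mono α} (h2 : sortS m.2 = none) : monoNF m = [] := by
  unfold monoNF; rw [h2]; cases sortS m.1 <;> rfl

/-- **`normalizeM` of ONE monomial with coefficient `1`**, both halves sorting. [cite: BratteliRobinsonII1997, §5.2.2] -/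
theorem normalizeM_single_some (enc : α → ℕ) (B : ℕ) {μ : CARPoly.Mono α} {lc la : List α × Bool}
    (h1 : sortS μ.1 = some lc) (h2 : sortS μ.2 = some la) :
    normalizeM enc B [(μ, 1)] = [((lc.1, la.1), 1 * sgnQ (xor lc.2 la.2))] := by
  rw [normalizeM, termsToPolyM, List.flatMap_cons, List.flatMap_nil, List.append_nil, monoNF_some h1 h2, List.map_cons,
    List.map_nil, collect_single, if_neg]
  rw [one_mul]; exact sgnQ_ne_zero _

/-- `normalizeM` of one monomial whose creators do not sort. [folklore] -/
theorem normalizeM_single_none1 (enc : α → ℕ) (B : ℕ) {μ : CARPoly.Mono α} (h1 : sortS μ.1 = none) :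
    normalizeM enc B [(μ, 1)] = [] := by
  rw [normalizeM, termsToPolyM, List.flatMap_cons, List.flatMap_nil, List.append_nil, monoNF_none1 h1]; rfl

/-- `normalizeM` of one monomial whose annihilators do not sort. [folklore] -/
theorem normalizeM_single_none2 (enc : α → ℕ) (B : ℕ) {μ : CARPoly.Mono α} (h2 : sortS μ.2 = none) :
    normalizeM enc B [(μ, 1)] = [] := by
  rw [normalizeM, termsToPolyM, List.flatMap_cons, List.flatMap_nil, List.append_nil, monoNF_none2 h2]; rfl

/-- The sign literal `1 * sgnQ s` is `±1`. [folklore] -/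
theorem one_mul_sgnQ_cases (s : Bool) : 1 * sgnQ s = 1 ∨ 1 * sgnQ s = -1 := by cases s <;> simp [sgnQ]

/-- Reading the parity back from the sign literal. [folklore] -/
theorem decide_one_mul_sgnQ (s : Bool) : decide (1 * sgnQ s = -1) = s := by cases s <;> norm_num [sgnQ]

end Single

/-! ## §2 Box letter maps on codes -/

section BoxCodes

open BoxGeom

/-- Closed-form push on codes. [folklore] -/
def pushC (r R : ℕ) (e : ℕ) : ℕ :=
  2 * (((e / 2 / side r + (R - r)) % side R) * side R + (e / 2 % side r + (R - r)) % side R) + e % 2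

/-- Closed-form move `x ↦ γ·x + v` on codes (`w = v + vmax`). [cite: Han2020Bootstrap, §3] -/
def gqC (r R vmax : ℕ) (c : ℕ) (w1 w2 : ℕ) (e : ℕ) : ℕ :=
  let p := d4N (2 * R) c (e / 2 / side r + (R - r)) (e / 2 % side r + (R - r))
  2 * (((p.1 + w1 - vmax) % side R) * side R + (p.2 + w2 - vmax) % side R) + e % 2

/-- `pushC` IS `pushN` on codes. [folklore] -/
theorem encL_pushN (r R : ℕ) (b : Orb (Fin (boxN r))) : SOSDual.encL (pushN r R b) = pushC r R (SOSDual.encL b) := by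
  rw [pushC, encL_div_two, encL_mod_two, pushN, encL_orb]
  rfl

/-- `gqC` IS `gqN` on codes. [cite: Han2020Bootstrap, §3] -/
theorem encL_gqN (r R vmax : ℕ) (c : Fin 8) (w1 w2 : ℕ) (b : Orb (Fin (boxN r))) :
    SOSDual.encL (gqN r R vmax c w1 w2 b) = gqC r R vmax c.val w1 w2 (SOSDual.encL b) := by
  rw [gqC, encL_div_two, encL_mod_two, gqN, encL_orb]
  rfl

/-- `encM encL` of a pushed monomial. [folklore] -/
theorem encM_mapMono_pushN (r R : ℕ) (μ : CARPoly.Mono (Orb (Fin (boxN r)))) :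
    encM SOSDual.encL (mapMono (pushN r R) μ) = ((encM SOSDual.encL μ).1.map (pushC r R), (encM SOSDual.encL μ).2.map (pushC r R)) := by
  simp only [encM, mapMono, List.map_map, Function.comp_def, encL_pushN]

/-- `encM encL` of a moved monomial. [folklore] -/
theorem encM_mapMono_gqN (r R vmax : ℕ) (c : Fin 8) (w1 w2 : ℕ) (μ : CARPoly.Mono (Orb (Fin (boxN r)))) :
    encM SOSDual.encL (mapMono (gqN r R vmax c w1 w2) μ) =
      ((encM SOSDual.encL μ).1.map (gqC r R vmax c.val w1 w2), (encM SOSDual.encL μ).2.map (gqC r R vmax c.val w1 w2)) := by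
  simp only [encM, mapMono, List.map_map, Function.comp_def, encL_gqN]

/-- **The move on codes with the `D₄` case dispatched ONCE per hint and per-hint constants folded** (`s = side r`, `S = side R`,
`A_i = w_i + (R − r) − vmax`, `B_i = R + r + w_i − vmax`): nine ℕ operations per letter, no `%`. [cite: Han2020Bootstrap, §3] -/
def gqK (s S A1 A2 B1 B2 : ℕ) (c : ℕ) : ℕ → ℕ :=
  match c with
  | 0 => fun e => 2 * ((e / 2 / s + A1) * S + (e / 2 % s + A2)) + e % 2
  | 1 => fun e => 2 * ((B1 - e / 2 % s) * S + (e / 2 / s + A2)) + e % 2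
  | 2 => fun e => 2 * ((B1 - e / 2 / s) * S + (B2 - e / 2 % s)) + e % 2
  | 3 => fun e => 2 * ((e / 2 % s + A1) * S + (B2 - e / 2 / s)) + e % 2
  | 4 => fun e => 2 * ((e / 2 / s + A1) * S + (B2 - e / 2 % s)) + e % 2
  | 5 => fun e => 2 * ((B1 - e / 2 % s) * S + (B2 - e / 2 / s)) + e % 2
  | 6 => fun e => 2 * ((B1 - e / 2 / s) * S + (e / 2 % s + A2)) + e % 2
  | _ => fun e => 2 * ((e / 2 % s + A1) * S + (e / 2 / s + A2)) + e % 2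

/-- `gqK` IS `gqC` on the code of an inner letter, for a licensed move at `r + vmax ≤ R` (no wrap: every `%` of `gqC` is the identity).
[cite: Han2020Bootstrap, §3] -/
theorem gqK_encL {r R vmax : ℕ} (hR : r + vmax ≤ R) (c : Fin 8) (v : ℤ × ℤ) (hok : boxOk vmax c v = true) (b : Orb (Fin (boxN r))) :
    gqK (side r) (side R) ((v.1 + (vmax : ℤ)).toNat + (R - r) - vmax) ((v.2 + (vmax : ℤ)).toNat + (R - r) - vmax)
      (R + r + (v.1 + (vmax : ℤ)).toNat - vmax) (R + r + (v.2 + (vmax : ℤ)).toNat - vmax) c.val (SOSDual.encL b) =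
    gqC r R vmax c.val (v.1 + (vmax : ℤ)).toNat (v.2 + (vmax : ℤ)).toNat (SOSDual.encL b) := by
  have hv : -(vmax : ℤ) ≤ v.1 ∧ v.1 ≤ vmax ∧ -(vmax : ℤ) ≤ v.2 ∧ v.2 ≤ vmax := of_decide_eq_true hok
  have hw1 : (v.1 + (vmax : ℤ)).toNat ≤ 2 * vmax := by omega
  have hw2 : (v.2 + (vmax : ℤ)).toNat ≤ 2 * vmax := by omega
  have he2 := encL_div_two b
  have hj : (ofLex b).1.val < side r * side r := (ofLex b).1.isLt
  have hsr : side r = 2 * r + 1 := rfl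
  have hsR : side R = 2 * R + 1 := rfl
  have hX : (ofLex b).1.val / side r ≤ 2 * r := by
    have := Nat.div_lt_of_lt_mul hj; omega
  have hY : (ofLex b).1.val % side r ≤ 2 * r := by
    have := Nat.mod_lt (ofLex b).1.val (side_pos r); omega
  generalize SOSDual.encL b = e at he2 ⊢
  generalize (v.1 + (vmax : ℤ)).toNat = w1 at hw1 ⊢
  generalize (v.2 + (vmax : ℤ)).toNat = w2 at hw2 ⊢
  have m1 : ∀ t, t ≤ 2 * R → t % side R = t := fun t ht => Nat.mod_eq_of_lt (by rw [hsR]; omega)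
  have hc := c.isLt
  generalize c.val = k at hc ⊢
  interval_cases k <;>
    (simp only [gqK, gqC, d4N]
     rw [he2]
     generalize (ofLex b).1.val / side r = X at hX ⊢
     generalize (ofLex b).1.val % side r = Y at hY ⊢
     rw [m1 _ (by omega), m1 _ (by omega)]
     generalize side R = S
     congr 1; congr 1; congr 1 <;> first | omega | (congr 1; omega))

end BoxCodes

/-! ## §3 The stages on keyed code terms -/

section Stages

open BoxGeom

variable (r R vmax : ℕ)

/-- A code hint row: (key of the target, (parity, inner code monomial)) — the key alone identifies the target (`key_inj`). [folklore] -/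
abbrev RowN := ℕ × (Bool × MonoN)

/-- Rows of the licensed hints whose moved monomial has a normal form — straight from `monoNFN`, one key. [cite: Han2020Bootstrap, §3] -/
def hintRowsN {Nβ : ℕ} (B : ℕ) (H : List (QHint Nβ)) : List RowN :=
  H.filterMap fun h =>
    bif boxOk vmax h.γ h.v then
      let w1 := (h.v.1 + (vmax : ℤ)).toNat
      let w2 := (h.v.2 + (vmax : ℤ)).toNat
      let g := gqK (side r) (side R) (w1 + (R - r) - vmax) (w2 + (R - r) - vmax) (R + r + w1 - vmax) (R + r + w2 - vmax) h.γ.val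
      match monoNFN (((encM SOSDual.encL h.μ).1.map g), ((encM SOSDual.encL h.μ).2.map g)) with
      | some ns => some (keyN B ns.1, (ns.2, encM SOSDual.encL h.μ))
      | none => none
    else none

/-- Drop leading rows with key below `k`. [folklore] -/
def dropBehindN (k : ℕ) : List RowN → List RowN
  | [] => []
  | ρ :: ρs => bif Nat.blt ρ.1 k then dropBehindN k ρs else ρ :: ρs

/-- An annotated keyed term. [folklore] -/
abbrev ATermN := KTerm × Option (Bool × MonoN)

/-- The merge-walk on keyed terms: accept a row iff the keys match. [folklore] -/
def annotateN : List KTerm → List RowN → List ATermN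
  | [], _ => []
  | t :: P, ρs =>
    match dropBehindN t.1 ρs with
    | [] => (t, none) :: annotateN P []
    | ρ :: ρs' => bif Nat.beq ρ.1 t.1 then (t, some ρ.2) :: annotateN P ρs' else (t, none) :: annotateN P (ρ :: ρs')

/-- Zero-class test on codes: the pushed monomial normal-orders to `+ (the term's monomial)`. [cite: Han2020Bootstrap, §3] -/
def zeroTestN (B : ℕ) (μ' : MonoN) (t : KTerm) : Bool :=
  match monoNFN μ' with
  | some ns => !ns.2 && Nat.beq (keyN B ns.1) t.1
  | none => false

/-- Quotient out, as (code monomial, coefficient) pairs (to be normal-ordered by `termsToPolyKM`). [cite: Han2020Bootstrap, §3] -/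
def quotOutNM (B : ℕ) (A : List ATermN) : List (MonoN × ℚ) :=
  A.flatMap fun a => match a.2 with
    | none => [(a.1.2.1, a.1.2.2)]
    | some e =>
      let μ' : MonoN := (e.2.1.map (pushC r R), e.2.2.map (pushC r R))
      bif e.1 && zeroTestN B μ' a.1 then [] else [(μ', if e.1 then -a.1.2.2 else a.1.2.2)]

/-- Normal-order a (code monomial, coefficient) list into keyed terms. [cite: BratteliRobinsonII1997, §5.2.2] -/
def termsToPolyKM (B : ℕ) (Q : List (MonoN × ℚ)) : List KTerm :=
  Q.flatMap fun mc => match monoNFN mc.1 with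
    | some ns => [(keyN B ns.1, (ns.1, if ns.2 then -mc.2 else mc.2))]
    | none => []

/-- Adjoint pass on keyed terms, as (code monomial, coefficient) pairs. [cite: Han2020Bootstrap, §3] -/
def adjOutNM (B : ℕ) (P : List KTerm) : List (MonoN × ℚ) :=
  P.map fun t =>
    match monoNFN (t.2.1.2.reverse, t.2.1.1.reverse) with
    | none => (t.2.1, t.2.2)
    | some ns => bif Nat.blt (keyN B ns.1) t.1 then (ns.1, if ns.2 then -t.2.2 else t.2.2) else (t.2.1, t.2.2)

/-- Keyed code terms as an encoded polynomial (codes ARE the `encPoly` letters). [folklore] -/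
def toEnc (P : List KTerm) : SOSDual.EncPoly := P.map fun t => ((t.2.1.1, t.2.1.2), (t.2.2.num, t.2.2.den))

/-- **THE CODE STEP at a box geometry** (falls back to `stepEQA` when `r + vmax > R`). [cite: JanssonChaykinKeil2008, §3]
[cite: Han2020Bootstrap, §3] -/
def stepEQN (B : ℕ) (C : SOSDual.EncPoly) (T : Terms (Orb (Fin (boxN R)))) (H : List (QHint (boxN r))) : SOSDual.EncPoly :=
  if r + vmax ≤ R ∧ 2 * boxN R + 1 ≤ B then
    let P0 := collectK (termsToPolyKN SOSDual.encL B T)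
    let A := annotateN P0 (sortByKeyB (hintRowsN r R vmax B H))
    let P1 := collectK (termsToPolyKM B (quotOutNM r R B A))
    SOSDual.mergeE B C (toEnc (collectK (termsToPolyKM B (adjOutNM B P1))))
  else stepEQA (boxQuot r R vmax) B C T H

end Stages

end CARPolyWindow

end Summit.Ventures.CertifiedManyBodySolver
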